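import Summits.FinalStateConjecture.FinalStateConjecture.Theorems.EIHFluxBalanceInertialRecessionStubCoerMomKernelStepTwo
import Summits.FinalStateConjecture.FinalStateConjecture.Theorems.EIHFluxBalanceInertialRecessionStubCoerMomKernelCovLT
import Summits.FinalStateConjecture.FinalStateConjecture.Theorems.EIHFluxBalanceInertialRecessionStubCoerMomKernelFrames
import Summits.FinalStateConjecture.FinalStateConjecture.Theorems.EIHFluxBalanceInertialRecessionSlavingFarFieldBk
import Summits.FinalStateConjecture.FinalStateConjecture.Theorems.EIHFluxBalanceInertialRecessionSlavingFarFieldSpinVarRows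
import Summits.FinalStateConjecture.FinalStateConjecture.Theorems.EIHFluxBalanceInertialRecessionSlavingFarFieldSkew
import Summits.FinalStateConjecture.FinalStateConjecture.Theorems.EIHFluxBalanceInertialRecessionLorentz

/-!
# Route EIHFluxBalance — `InertialRecession` (E′), line `SketchCleanExcision`, skeleton r13,
# stub `stub_coerMomKernel` (Bk), part 8a: TRANSPORT of the flat identities to the table frame

Helper file for the crux `stmt-FinalStateConjecture-17403`
(`Summit.FinalStateConjecture.FinalStateConjecture.Theses.EIHFluxBalance.InertialRecession`, E′),
registered stub `stub_coerMomKernel` (Bk, the LEAD's stub; proved by seat 1 in part 8b) of skeleton r13: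

* `bk_radius_pos_slice` — the rest image of a nonzero slice point is off the time axis
  (one-line registered carrier `bk_transport_carrier`);
* `bk_rows_I`, `bk_rows_II` — the flat far-field identities (parts 3–5) in the form of the flat
  momentum operator `Σᵢ (∂_eV(eᵢ,eᵢ) − ∂_{eᵢ}V(eᵢ,e))` (`bk_flatRow`), at every slice point, every `e`;
* `bk_transport_var`, `bk_transport_var_eq` — the rows of the first-variation field with frame
  `S = R ∘ S₀ ∘ N` are the rows of the conjugate field with frame `S₀` (parts 6a, 7);
* `bk_transport_spin` — the same for the spin first-variation field, landing on the scalar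
  Lense–Thirring field of the tables with the transported spin vector (parts 6a, 6b).

No definitions, no named facts, no `sorry`.
-/

set_option linter.dupNamespace false
set_option maxSynthPendingDepth 6
set_option synthInstance.maxHeartbeats 200000

noncomputable section

open Set Function Filter ContinuousLinearMap Literature.Geometry.Lorentzian
  Literature.Geometry.Lorentzian.MetricCoord Literature.Geometry.Lorentzian.Schwarzschild
open scoped Topology ContDiff InnerProductSpace

namespace Summit.FinalStateConjecture.FinalStateConjecture.Theorems.SublinearIsFree.Slaving


/-! ### Slice points are off the painted time axis -/

/-- **The rest image of a nonzero slice point is off the time axis**: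
`r_0(Λ⁻¹(0, y)) > 0` for `y ≠ 0` (`‖(Λ⁻¹x)⃗‖² = ‖x‖² + ((Λ⁻¹x)⁰)²` for spatial `x`). [folklore] -/
theorem bk_radius_pos_slice (L : lorentzGroup) {x : E4} (hx0 : x 0 = 0) (hx : x ≠ 0) :
    0 < Kerr.radius 0 (((L : E4 ≃L[ℝ] E4).symm : E4 →L[ℝ] E4) x) := by
  rw [Kerr.radius_zero_left]
  have h := spatialNorm_lorentz_apply_sq L⁻¹ hx0
  rw [coe_lorentz_inv] at h
  have hxn : 0 < ‖x‖ := norm_pos_iff.2 hx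
  have h2 : 0 < E4.spatialNorm ((L : E4 ≃L[ℝ] E4).symm x) ^ 2 := by
    nlinarith [sq_nonneg (((L : E4 ≃L[ℝ] E4).symm x) 0)]
  have goal' : 0 < E4.spatialNorm ((L : E4 ≃L[ℝ] E4).symm x) := by
    rcases (E4.spatialNorm_nonneg ((L : E4 ≃L[ℝ] E4).symm x)).lt_or_eq with hlt | heq
    · exact hlt
    · exfalso
      rw [← heq] at h2
      simp at h2
  exact goal'

/-! ### The flat identities in momentum-operator form -/

set_option maxHeartbeats 1600000 in
/-- **(I) in operator form**: under Bk's hypothesis, at every nonzero slice point `x` and for every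
spatial `e`, `Σᵢ (∂_eVar_{(1,0,A,0)}(x)(eᵢ,eᵢ) − ∂_{eᵢ}Var_{(1,0,A,0)}(x)(eᵢ,e)) = 0`
(`bk_scaled_identity`, `bk_step_one`, `bk_flatRow`). [folklore] -/
theorem bk_rows_I {M a : ℝ} (hM : 0 < M) (L : lorentzGroup) {A : E4 →L[ℝ] E4}
    (hA : ∀ u w : E4, Minkowski.bilin (A u) w + Minkowski.bilin u (A w) = 0) (d : E4) {ρ₀ : ℝ}
    (H : ∀ y : E3, ρ₀ ≤ ‖y‖ → 2 * M < Kerr.radius a (((L : E4 ≃L[ℝ] E4).symm : E4 →L[ℝ] E4) (E4.ofTimeSpace 0 y)) →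
      ∀ e : E4, e 0 = 0 → ricAt (fun z : E4 ↦ boostedKerrBilin L 0 M a z + (z 0) • ((fderiv ℝ (Kerr.bilin M a) (((L : E4 ≃L[ℝ] E4).symm : E4 →L[ℝ] E4) z) (A (((L : E4 ≃L[ℝ] E4).symm : E4 →L[ℝ] E4) z) + d)).bilinearComp ((L : E4 ≃L[ℝ] E4).symm : E4 →L[ℝ] E4) ((L : E4 ≃L[ℝ] E4).symm : E4 →L[ℝ] E4) + (Kerr.bilin M a (((L : E4 ≃L[ℝ] E4).symm : E4 →L[ℝ] E4) z)).bilinearComp (A.comp ((L : E4 ≃L[ℝ] E4).symm : E4 →L[ℝ] E4)) ((L : E4 ≃L[ℝ] E4).symm : E4 →L[ℝ] E4) + (Kerr.bilin M a (((L : E4 ≃L[ℝ] E4).symm : E4 →L[ℝ] E4) z)).bilinearComp ((L : E4 ≃L[ℝ] E4).symm : E4 →L[ℝ] E4) (A.comp ((L : E4 ≃L[ℝ] E4).symm : E4 →L[ℝ] E4)))) (E4.ofTimeSpace 0 y) (sharpAt (boostedKerrBilin L 0 M a) (E4.ofTimeSpace 0 y) (E4.dx 0)) e = 0)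
    {x : E4} (hx0 : x 0 = 0) (hx : x ≠ 0) {e : E4} (he : e 0 = 0) :
    ∑ i : Fin 3, (fderiv ℝ (fun z : E4 ↦ ((fderiv ℝ (Kerr.bilin 1 0) (((L : E4 ≃L[ℝ] E4).symm : E4 →L[ℝ] E4) z) (A (((L : E4 ≃L[ℝ] E4).symm : E4 →L[ℝ] E4) z) + 0)).bilinearComp ((L : E4 ≃L[ℝ] E4).symm : E4 →L[ℝ] E4) ((L : E4 ≃L[ℝ] E4).symm : E4 →L[ℝ] E4) + (Kerr.bilin 1 0 (((L : E4 ≃L[ℝ] E4).symm : E4 →L[ℝ] E4) z)).bilinearComp (A.comp ((L : E4 ≃L[ℝ] E4).symm : E4 →L[ℝ] E4)) ((L : E4 ≃L[ℝ] E4).symm : E4 →L[ℝ] E4) + (Kerr.bilin 1 0 (((L : E4 ≃L[ℝ] E4).symm : E4 →L[ℝ] E4) z)).bilinearComp ((L : E4 ≃L[ℝ] E4).symm : E4 →L[ℝ] E4) (A.comp ((L : E4 ≃L[ℝ] E4).symm : E4 →L[ℝ] E4)))) x e (E4.basisVector i.succ) (E4.basisVector i.succ)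
      - fderiv ℝ (fun z : E4 ↦ ((fderiv ℝ (Kerr.bilin 1 0) (((L : E4 ≃L[ℝ] E4).symm : E4 →L[ℝ] E4) z) (A (((L : E4 ≃L[ℝ] E4).symm : E4 →L[ℝ] E4) z) + 0)).bilinearComp ((L : E4 ≃L[ℝ] E4).symm : E4 →L[ℝ] E4) ((L : E4 ≃L[ℝ] E4).symm : E4 →L[ℝ] E4) + (Kerr.bilin 1 0 (((L : E4 ≃L[ℝ] E4).symm : E4 →L[ℝ] E4) z)).bilinearComp (A.comp ((L : E4 ≃L[ℝ] E4).symm : E4 →L[ℝ] E4)) ((L : E4 ≃L[ℝ] E4).symm : E4 →L[ℝ] E4) + (Kerr.bilin 1 0 (((L : E4 ≃L[ℝ] E4).symm : E4 →L[ℝ] E4) z)).bilinearComp ((L : E4 ≃L[ℝ] E4).symm : E4 →L[ℝ] E4) (A.comp ((L : E4 ≃L[ℝ] E4).symm : E4 →L[ℝ] E4)))) x (E4.basisVector i.succ) (E4.basisVector i.succ) e) = 0 := by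
  set S : E4 →L[ℝ] E4 := ((L : E4 ≃L[ℝ] E4).symm : E4 →L[ℝ] E4) with hS
  have hy : E4.spatial x ≠ 0 := by
    intro h
    apply hx
    rw [← E4.ofTimeSpace_time_spatial x, E4.time_apply, hx0, h]
    ext i; refine Fin.cases ?_ (fun j ↦ ?_) i <;> simp
  have hxe : E4.ofTimeSpace 0 (E4.spatial x) = x := by
    conv_rhs => rw [← E4.ofTimeSpace_time_spatial x, E4.time_apply, hx0]
  have hrad : 0 < Kerr.radius 0 (S x) := bk_radius_pos_slice L hx0 hx
  obtain ⟨ε₀, hε₀, hid⟩ := bk_scaled_identity hM L hA d H hy he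
  rw [hxe] at hid
  have h1 := bk_step_one L M a A d hx0 hrad (e := e) ⟨ε₀, hε₀, fun ε h1 h2 ↦ (hid ε h1 h2).2⟩
  obtain ⟨hU, hVc⟩ := coerMomQ_contDiffOn_var 1 0 S A 0
  have hVs : ∀ z ∈ {z : E4 | 0 < Kerr.radius 0 (S z)}, ∀ v w : E4, (((fderiv ℝ (Kerr.bilin 1 0) (S z) (A (S z) + 0)).bilinearComp S S + (Kerr.bilin 1 0 (S z)).bilinearComp (A.comp S) S + (Kerr.bilin 1 0 (S z)).bilinearComp S (A.comp S))) v w = (((fderiv ℝ (Kerr.bilin 1 0) (S z) (A (S z) + 0)).bilinearComp S S + (Kerr.bilin 1 0 (S z)).bilinearComp (A.comp S) S + (Kerr.bilin 1 0 (S z)).bilinearComp S (A.comp S))) w v :=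
    fun z hz v w ↦ coerMomQ_var_symm 1 0 S A 0 hz v w
  have h2 := bk_flatRow hU hrad hx0 hVc hVs he
  rw [h1] at h2
  have h3 := h2.symm
  rcases mul_eq_zero.1 h3 with h | h
  · norm_num at h
  · exact h

set_option maxHeartbeats 1600000 in
/-- **(II) in operator form**: under Bk's hypothesis and `A e₀ = 0`, at every nonzero slice point
`x`, for every spatial `e`: `a · rows(spinVar_{(1,A,0)}) + rows(Var_{(1,0,0,d)}) = 0`
(`bk_scaled_identity`, `bk_step_two`, `bk_flatRow`). [folklore] -/
theorem bk_rows_II {M a : ℝ} (hM : 0 < M) (L : lorentzGroup) {A : E4 →L[ℝ] E4}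
    (hA : ∀ u w : E4, Minkowski.bilin (A u) w + Minkowski.bilin u (A w) = 0)
    (hA0 : A (E4.basisVector 0) = 0) (d : E4) {ρ₀ : ℝ}
    (H : ∀ y : E3, ρ₀ ≤ ‖y‖ → 2 * M < Kerr.radius a (((L : E4 ≃L[ℝ] E4).symm : E4 →L[ℝ] E4) (E4.ofTimeSpace 0 y)) →
      ∀ e : E4, e 0 = 0 → ricAt (fun z : E4 ↦ boostedKerrBilin L 0 M a z + (z 0) • ((fderiv ℝ (Kerr.bilin M a) (((L : E4 ≃L[ℝ] E4).symm : E4 →L[ℝ] E4) z) (A (((L : E4 ≃L[ℝ] E4).symm : E4 →L[ℝ] E4) z) + d)).bilinearComp ((L : E4 ≃L[ℝ] E4).symm : E4 →L[ℝ] E4) ((L : E4 ≃L[ℝ] E4).symm : E4 →L[ℝ] E4) + (Kerr.bilin M a (((L : E4 ≃L[ℝ] E4).symm : E4 →L[ℝ] E4) z)).bilinearComp (A.comp ((L : E4 ≃L[ℝ] E4).symm : E4 →L[ℝ] E4)) ((L : E4 ≃L[ℝ] E4).symm : E4 →L[ℝ] E4) + (Kerr.bilin M a (((L : E4 ≃L[ℝ]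 E4).symm : E4 →L[ℝ] E4) z)).bilinearComp ((L : E4 ≃L[ℝ] E4).symm : E4 →L[ℝ] E4) (A.comp ((L : E4 ≃L[ℝ] E4).symm : E4 →L[ℝ] E4)))) (E4.ofTimeSpace 0 y) (sharpAt (boostedKerrBilin L 0 M a) (E4.ofTimeSpace 0 y) (E4.dx 0)) e = 0)
    {x : E4} (hx0 : x 0 = 0) (hx : x ≠ 0) {e : E4} (he : e 0 = 0) :
    a * ∑ i : Fin 3, (fderiv ℝ (fun z : E4 ↦ ((fderiv ℝ (Kerr.spinMetric 1) (((L : E4 ≃L[ℝ] E4).symm : E4 →L[ℝ] E4) z) (A (((L : E4 ≃L[ℝ] E4).symm : E4 →L[ℝ] E4) z) + 0)).bilinearComp ((L : E4 ≃L[ℝ] E4).symm : E4 →L[ℝ] E4) ((L : E4 ≃L[ℝ] E4).symm : E4 →L[ℝ] E4) + (Kerr.spinMetric 1 (((L : E4 ≃L[ℝ] E4).symm : E4 →L[ℝ] E4) z)).bilinearComp (A.comp ((L : E4 ≃L[ℝ] E4).symm : E4 →L[ℝ] E4)) ((L : E4 ≃L[ℝ] E4).symm : E4 →L[ℝ] E4)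 + (Kerr.spinMetric 1 (((L : E4 ≃L[ℝ] E4).symm : E4 →L[ℝ] E4) z)).bilinearComp ((L : E4 ≃L[ℝ] E4).symm : E4 →L[ℝ] E4) (A.comp ((L : E4 ≃L[ℝ] E4).symm : E4 →L[ℝ] E4)))) x e (E4.basisVector i.succ) (E4.basisVector i.succ)
      - fderiv ℝ (fun z : E4 ↦ ((fderiv ℝ (Kerr.spinMetric 1) (((L : E4 ≃L[ℝ] E4).symm : E4 →L[ℝ] E4) z) (A (((L : E4 ≃L[ℝ] E4).symm : E4 →L[ℝ] E4) z) + 0)).bilinearComp ((L : E4 ≃L[ℝ] E4).symm : E4 →L[ℝ] E4) ((L : E4 ≃L[ℝ] E4).symm : E4 →L[ℝ] E4) + (Kerr.spinMetric 1 (((L : E4 ≃L[ℝ] E4).symm : E4 →L[ℝ] E4) z)).bilinearComp (A.comp ((L : E4 ≃L[ℝ] E4).symm : E4 →L[ℝ] E4)) ((L : E4 ≃L[ℝ] E4).symm : E4 →L[ℝ] E4) + (Kerr.spinMetric 1 (((L : E4 ≃L[ℝ] E4).symm : E4 →L[ℝ] E4) z)).bilinearComp ((L : E4 ≃L[ℝ]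 E4).symm : E4 →L[ℝ] E4) (A.comp ((L : E4 ≃L[ℝ] E4).symm : E4 →L[ℝ] E4)))) x (E4.basisVector i.succ) (E4.basisVector i.succ) e)
    + ∑ i : Fin 3, (fderiv ℝ (fun z : E4 ↦ ((fderiv ℝ (Kerr.bilin 1 0) (((L : E4 ≃L[ℝ] E4).symm : E4 →L[ℝ] E4) z) ((0 : E4 →L[ℝ] E4) (((L : E4 ≃L[ℝ] E4).symm : E4 →L[ℝ] E4) z) + d)).bilinearComp ((L : E4 ≃L[ℝ] E4).symm : E4 →L[ℝ] E4) ((L : E4 ≃L[ℝ] E4).symm : E4 →L[ℝ] E4) + (Kerr.bilin 1 0 (((L : E4 ≃L[ℝ] E4).symm : E4 →L[ℝ] E4) z)).bilinearComp ((0 : E4 →L[ℝ] E4).comp ((L : E4 ≃L[ℝ] E4).symm : E4 →L[ℝ] E4)) ((L : E4 ≃L[ℝ] E4).symm : E4 →L[ℝ] E4) + (Kerr.bilin 1 0 (((L : E4 ≃L[ℝ] E4).symm : E4 →L[ℝ] E4) z)).bilinearComp ((L : E4 ≃L[ℝ] E4).symm : E4 →L[ℝ] E4) ((0 : E4 →L[ℝ]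 E4).comp ((L : E4 ≃L[ℝ] E4).symm : E4 →L[ℝ] E4)))) x e (E4.basisVector i.succ) (E4.basisVector i.succ)
      - fderiv ℝ (fun z : E4 ↦ ((fderiv ℝ (Kerr.bilin 1 0) (((L : E4 ≃L[ℝ] E4).symm : E4 →L[ℝ] E4) z) ((0 : E4 →L[ℝ] E4) (((L : E4 ≃L[ℝ] E4).symm : E4 →L[ℝ] E4) z) + d)).bilinearComp ((L : E4 ≃L[ℝ] E4).symm : E4 →L[ℝ] E4) ((L : E4 ≃L[ℝ] E4).symm : E4 →L[ℝ] E4) + (Kerr.bilin 1 0 (((L : E4 ≃L[ℝ] E4).symm : E4 →L[ℝ] E4) z)).bilinearComp ((0 : E4 →L[ℝ] E4).comp ((L : E4 ≃L[ℝ] E4).symm : E4 →L[ℝ] E4)) ((L : E4 ≃L[ℝ] E4).symm : E4 →L[ℝ] E4) + (Kerr.bilin 1 0 (((L : E4 ≃L[ℝ] E4).symm : E4 →L[ℝ] E4) z)).bilinearComp ((L : E4 ≃L[ℝ] E4).symm : E4 →L[ℝ] E4) ((0 : E4 →L[ℝ] E4).comp ((L : E4 ≃L[ℝ] E4).symm :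 E4 →L[ℝ] E4)))) x (E4.basisVector i.succ) (E4.basisVector i.succ) e) = 0 := by
  set S : E4 →L[ℝ] E4 := ((L : E4 ≃L[ℝ] E4).symm : E4 →L[ℝ] E4) with hS
  have hy : E4.spatial x ≠ 0 := by
    intro h
    apply hx
    rw [← E4.ofTimeSpace_time_spatial x, E4.time_apply, hx0, h]
    ext i; refine Fin.cases ?_ (fun j ↦ ?_) i <;> simp
  have hxe : E4.ofTimeSpace 0 (E4.spatial x) = x := by
    conv_rhs => rw [← E4.ofTimeSpace_time_spatial x, E4.time_apply, hx0]
  have hrad : 0 < Kerr.radius 0 (S x) := bk_radius_pos_slice L hx0 hx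
  obtain ⟨ε₀, hε₀, hid⟩ := bk_scaled_identity hM L hA d H hy he
  rw [hxe] at hid
  have h1 := bk_step_two L M a hA hA0 d hx0 hrad he ⟨ε₀, hε₀, fun ε h1 h2 ↦ (hid ε h1 h2).2⟩
  -- the flat rows of both fields
  obtain ⟨hU, hVc⟩ := coerMomQ_contDiffOn_var 1 0 S (0 : E4 →L[ℝ] E4) d
  have hVs : ∀ z ∈ {z : E4 | 0 < Kerr.radius 0 (S z)}, ∀ v w : E4, (((fderiv ℝ (Kerr.bilin 1 0) (S z) ((0 : E4 →L[ℝ] E4) (S z) + d)).bilinearComp S S + (Kerr.bilin 1 0 (S z)).bilinearComp ((0 : E4 →L[ℝ] E4).comp S) S + (Kerr.bilin 1 0 (S z)).bilinearComp S ((0 : E4 →L[ℝ] E4).comp S))) v w = (((fderiv ℝ (Kerr.bilin 1 0) (S z) ((0 : E4 →L[ℝ] E4) (S z) + d)).bilinearComp S S + (Kerr.bilin 1 0 (S z)).bilinearComp ((0 : E4 →L[ℝ] E4).comp S) S + (Kerr.bilin 1 0 (S z)).bilinearComp S ((0 : E4 →L[ℝ] E4).comp S))) w v :=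
    fun z hz v w ↦ coerMomQ_var_symm 1 0 S 0 d hz v w
  have h2 := bk_flatRow hU hrad hx0 hVc hVs he
  have hSc : ContDiffOn ℝ ∞ (fun z : E4 ↦ ((fderiv ℝ (Kerr.spinMetric 1) (S z) (A (S z) + 0)).bilinearComp S S + (Kerr.spinMetric 1 (S z)).bilinearComp (A.comp S) S + (Kerr.spinMetric 1 (S z)).bilinearComp S (A.comp S))) {z : E4 | 0 < Kerr.radius 0 (S z)} :=
    fun z hz ↦ (bk_contDiffAt_spinVar 1 S A 0 hz).contDiffWithinAt
  have hSs : ∀ z ∈ {z : E4 | 0 < Kerr.radius 0 (S z)}, ∀ v w : E4, (((fderiv ℝ (Kerr.spinMetric 1) (S z) (A (S z) + 0)).bilinearComp S S + (Kerr.spinMetric 1 (S z)).bilinearComp (A.comp S) S + (Kerr.spinMetric 1 (S z)).bilinearComp S (A.comp S))) v w = (((fderiv ℝ (Kerr.spinMetric 1) (S z) (A (S z) + 0)).bilinearComp S S + (Kerr.spinMetric 1 (S z)).bilinearComp (A.comp S) S + (Kerr.spinMetric 1 (S z)).bilinearComp S (A.comp S))) w v :=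
    fun z hz v w ↦ bk_spinVar_symm 1 S A 0 hz v w
  have h3 := bk_flatRow hU hrad hx0 hSc hSs he
  rw [h2, h3] at h1
  linear_combination 2 * h1

/-! ### Transport of the rows to the table frame -/

set_option maxHeartbeats 3200000 in
/-- **Transport of the first-variation rows.** Let `S = R ∘ S₀ ∘ N` with `R` an `η`-isometry
fixing `e₀` (right inverse `R⁻¹`) and `N` an involutive slice-preserving `η`-isometry. If the flat
momentum rows of `Var_{(1,0,A,d)}` (frame `S`) vanish at every nonzero slice point for every spatial
`e`, then so do the rows of `Var_{(1,0,R⁻¹AR,R⁻¹d)}` (frame `S₀`) at every slice point `q` with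
`r_0(S₀q) > 0`: the field with frame `S` is the pull-back by `N` of the conjugate field with frame
`S₀` (`bk_restMap_lieVar`, `bk_lieVar_comp_lab`), derivatives pull back (`bk_fderiv_pullback_apply`),
and the flat momentum operator is invariant under `N` (`bk_labIso_trace`, `bk_labIso_trace₃`).
[folklore] -/
theorem bk_transport_var (A : E4 →L[ℝ] E4) (d : E4) {S S₀ N Rr Rinv : E4 →L[ℝ] E4}
    (hNiso : ∀ u w : E4, Minkowski.bilin (N u) (N w) = Minkowski.bilin u w) (hNN : ∀ w : E4, N (N w) = w)
    (hNe0 : N (E4.basisVector 0) = E4.basisVector 0 ∨ N (E4.basisVector 0) = -E4.basisVector 0)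
    (hRiso : ∀ u w : E4, Minkowski.bilin (Rr u) (Rr w) = Minkowski.bilin u w)
    (hR0 : Rr (E4.basisVector 0) = E4.basisVector 0) (h1 : ∀ w : E4, Rr (Rinv w) = w)
    (hdec : ∀ v : E4, S v = Rr (S₀ (N v)))
    (hV : ∀ x : E4, x 0 = 0 → x ≠ 0 → ∀ e : E4, e 0 = 0 →
      ∑ i : Fin 3, (fderiv ℝ (fun z : E4 ↦ ((fderiv ℝ (Kerr.bilin 1 0) (S z) ((A) (S z) + d)).bilinearComp (S) (S) + (Kerr.bilin 1 0 (S z)).bilinearComp ((A).comp (S)) (S) + (Kerr.bilin 1 0 (S z)).bilinearComp (S) ((A).comp (S)))) x e (E4.basisVector i.succ) (E4.basisVector i.succ)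
        - fderiv ℝ (fun z : E4 ↦ ((fderiv ℝ (Kerr.bilin 1 0) (S z) ((A) (S z) + d)).bilinearComp (S) (S) + (Kerr.bilin 1 0 (S z)).bilinearComp ((A).comp (S)) (S) + (Kerr.bilin 1 0 (S z)).bilinearComp (S) ((A).comp (S)))) x (E4.basisVector i.succ) (E4.basisVector i.succ) e) = 0)
    {q : E4} (hq0 : q 0 = 0) (hq : 0 < Kerr.radius 0 (S₀ q)) {e : E4} (he : e 0 = 0) :
    ∑ i : Fin 3, (fderiv ℝ (fun z : E4 ↦ ((fderiv ℝ (Kerr.bilin 1 0) (S₀ z) (((Rinv.comp A).comp Rr) (S₀ z) + Rinv d)).bilinearComp (S₀) (S₀) + (Kerr.bilin 1 0 (S₀ z)).bilinearComp (((Rinv.comp A).comp Rr).comp (S₀)) (S₀) + (Kerr.bilin 1 0 (S₀ z)).bilinearComp (S₀) (((Rinv.comp A).comp Rr).comp (S₀)))) q e (E4.basisVector i.succ) (E4.basisVector i.succ)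
      - fderiv ℝ (fun z : E4 ↦ ((fderiv ℝ (Kerr.bilin 1 0) (S₀ z) (((Rinv.comp A).comp Rr) (S₀ z) + Rinv d)).bilinearComp (S₀) (S₀) + (Kerr.bilin 1 0 (S₀ z)).bilinearComp (((Rinv.comp A).comp Rr).comp (S₀)) (S₀) + (Kerr.bilin 1 0 (S₀ z)).bilinearComp (S₀) (((Rinv.comp A).comp Rr).comp (S₀)))) q (E4.basisVector i.succ) (E4.basisVector i.succ) e) = 0 := by
  -- names for the two fields
  obtain ⟨V, hVdef⟩ : ∃ V : E4 → E4 →L[ℝ] E4 →L[ℝ] ℝ, V = fun z ↦ ((fderiv ℝ (Kerr.bilin 1 0) (S z) ((A) (S z) + d)).bilinearComp (S) (S) + (Kerr.bilin 1 0 (S z)).bilinearComp ((A).comp (S)) (S) + (Kerr.bilin 1 0 (S z)).bilinearComp (S) ((A).comp (S))) := ⟨_, rfl⟩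
  obtain ⟨W, hWdef⟩ : ∃ W : E4 → E4 →L[ℝ] E4 →L[ℝ] ℝ, W = fun z ↦ ((fderiv ℝ (Kerr.bilin 1 0) (S₀ z) (((Rinv.comp A).comp Rr) (S₀ z) + Rinv d)).bilinearComp (S₀) (S₀) + (Kerr.bilin 1 0 (S₀ z)).bilinearComp (((Rinv.comp A).comp Rr).comp (S₀)) (S₀) + (Kerr.bilin 1 0 (S₀ z)).bilinearComp (S₀) (((Rinv.comp A).comp Rr).comp (S₀))) := ⟨_, rfl⟩
  rw [← hWdef]
  simp only [← hVdef] at hV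
  -- the lab point `p = N q` and the lab vector `N e`
  set p : E4 := N q with hp
  have hNp : N p = q := by rw [hp, hNN]
  have hp0 : p 0 = 0 := bk_labIso_apply_zero_of_spatial hNiso hNe0 hq0
  have hSp : S p = Rr (S₀ q) := by rw [hdec, hNp]
  have hradp : 0 < Kerr.radius 0 (S p) := by rw [hSp, bk_restMap_radius hRiso hR0]; exact hq
  have hpne : p ≠ 0 := by
    intro h0
    rw [h0, map_zero, Kerr.radius_zero_left] at hradp
    simp [E4.spatialNorm] at hradp
  have hNe : N e 0 = 0 := bk_labIso_apply_zero_of_spatial hNiso hNe0 he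
  have hrow := hV p hp0 hpne (N e) hNe
  -- `V = N^* W` near `p`
  have hU : IsOpen {z : E4 | 0 < Kerr.radius 0 (S z)} :=
    isOpen_lt continuous_const ((Kerr.continuous_radius 0).comp S.continuous)
  have hVW : ∀ z ∈ {z : E4 | 0 < Kerr.radius 0 (S z)}, V z = (W (N z)).bilinearComp N N := by
    intro z hz
    have hz' : 0 < Kerr.radius 0 ((S₀.comp N) z) := by
      have h := hz
      rw [Set.mem_setOf_eq, hdec, bk_restMap_radius hRiso hR0] at h
      exact h
    rw [hVdef, hWdef]
    dsimp only
    rw [bk_restMap_lieVar hRiso hR0 1 h1 (S₀.comp N) A S d (fun v ↦ by rw [hdec]; rfl) hz']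
    exact bk_lieVar_comp_lab (Kerr.bilin 1 0) S₀ N ((Rinv.comp A).comp Rr) (S₀.comp N) (Rinv d) z
      (fun v ↦ rfl)
  have hev : V =ᶠ[𝓝 p] fun z ↦ (W (N z)).bilinearComp N N := by
    filter_upwards [hU.mem_nhds hradp] with z hz
    exact hVW z hz
  have hfd : fderiv ℝ V p = fderiv ℝ (fun z ↦ (W (N z)).bilinearComp N N) p := hev.fderiv_eq
  -- `W` is differentiable at `N p = q`
  have hWd : DifferentiableAt ℝ W (N p) := by
    rw [hNp, hWdef]
    obtain ⟨hU₀, hWc⟩ := coerMomQ_contDiffOn_var 1 0 S₀ ((Rinv.comp A).comp Rr) (Rinv d)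
    exact (hWc.contDiffAt (hU₀.mem_nhds hq)).differentiableAt (by simp)
  have hpull : ∀ X U' W' : E4, fderiv ℝ (fun z ↦ (W (N z)).bilinearComp N N) p X U' W' =
      fderiv ℝ W (N p) (N X) (N U') (N W') := fun X U' W' ↦ bk_fderiv_pullback_apply N hWd X U' W'
  simp only [hfd, hpull, hNp, hNN] at hrow
  rw [Finset.sum_sub_distrib, bk_labIso_trace hNiso hNN hNe0 (fderiv ℝ W q e),
    bk_labIso_trace₃ hNiso hNN hNe0 (fderiv ℝ W q) e, ← Finset.sum_sub_distrib] at hrow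
  exact hrow

set_option maxHeartbeats 3200000 in
/-- **Transport of the first-variation rows (equality form).** With the data of
`bk_transport_var`: the rows of `Var_{(1,0,A,d)}` (frame `S`) at `(Nq, Ne)` equal the rows of
`Var_{(1,0,R⁻¹AR,R⁻¹d)}` (frame `S₀`) at `(q, e)`, whenever `r_0(S₀q) > 0`. [folklore] -/
theorem bk_transport_var_eq (A : E4 →L[ℝ] E4) (d : E4) {S S₀ N Rr Rinv : E4 →L[ℝ] E4}
    (hNiso : ∀ u w : E4, Minkowski.bilin (N u) (N w) = Minkowski.bilin u w) (hNN : ∀ w : E4, N (N w) = w)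
    (hNe0 : N (E4.basisVector 0) = E4.basisVector 0 ∨ N (E4.basisVector 0) = -E4.basisVector 0)
    (hRiso : ∀ u w : E4, Minkowski.bilin (Rr u) (Rr w) = Minkowski.bilin u w)
    (hR0 : Rr (E4.basisVector 0) = E4.basisVector 0) (h1 : ∀ w : E4, Rr (Rinv w) = w)
    (hdec : ∀ v : E4, S v = Rr (S₀ (N v))) {q : E4} (hq : 0 < Kerr.radius 0 (S₀ q)) (e : E4) :
    ∑ i : Fin 3, (fderiv ℝ (fun z : E4 ↦ ((fderiv ℝ (Kerr.bilin 1 0) (S z) ((A) (S z) + d)).bilinearComp (S) (S) + (Kerr.bilin 1 0 (S z)).bilinearComp ((A).comp (S)) (S) + (Kerr.bilin 1 0 (S z)).bilinearComp (S) ((A).comp (S)))) (N q) (N e) (E4.basisVector i.succ) (E4.basisVector i.succ)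
        - fderiv ℝ (fun z : E4 ↦ ((fderiv ℝ (Kerr.bilin 1 0) (S z) ((A) (S z) + d)).bilinearComp (S) (S) + (Kerr.bilin 1 0 (S z)).bilinearComp ((A).comp (S)) (S) + (Kerr.bilin 1 0 (S z)).bilinearComp (S) ((A).comp (S)))) (N q) (E4.basisVector i.succ) (E4.basisVector i.succ) (N e))
      = ∑ i : Fin 3, (fderiv ℝ (fun z : E4 ↦ ((fderiv ℝ (Kerr.bilin 1 0) (S₀ z) (((Rinv.comp A).comp Rr) (S₀ z) + Rinv d)).bilinearComp (S₀) (S₀) + (Kerr.bilin 1 0 (S₀ z)).bilinearComp (((Rinv.comp A).comp Rr).comp (S₀)) (S₀) + (Kerr.bilin 1 0 (S₀ z)).bilinearComp (S₀) (((Rinv.comp A).comp Rr).comp (S₀)))) q e (E4.basisVector i.succ) (E4.basisVector i.succ)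
        - fderiv ℝ (fun z : E4 ↦ ((fderiv ℝ (Kerr.bilin 1 0) (S₀ z) (((Rinv.comp A).comp Rr) (S₀ z) + Rinv d)).bilinearComp (S₀) (S₀) + (Kerr.bilin 1 0 (S₀ z)).bilinearComp (((Rinv.comp A).comp Rr).comp (S₀)) (S₀) + (Kerr.bilin 1 0 (S₀ z)).bilinearComp (S₀) (((Rinv.comp A).comp Rr).comp (S₀)))) q (E4.basisVector i.succ) (E4.basisVector i.succ) e) := by
  obtain ⟨V, hVdef⟩ : ∃ V : E4 → E4 →L[ℝ] E4 →L[ℝ] ℝ, V = fun z ↦ ((fderiv ℝ (Kerr.bilin 1 0) (S z) ((A) (S z) + d)).bilinearComp (S) (S) + (Kerr.bilin 1 0 (S z)).bilinearComp ((A).comp (S)) (S) + (Kerr.bilin 1 0 (S z)).bilinearComp (S) ((A).comp (S))) := ⟨_, rfl⟩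
  obtain ⟨W, hWdef⟩ : ∃ W : E4 → E4 →L[ℝ] E4 →L[ℝ] ℝ, W = fun z ↦ ((fderiv ℝ (Kerr.bilin 1 0) (S₀ z) (((Rinv.comp A).comp Rr) (S₀ z) + Rinv d)).bilinearComp (S₀) (S₀) + (Kerr.bilin 1 0 (S₀ z)).bilinearComp (((Rinv.comp A).comp Rr).comp (S₀)) (S₀) + (Kerr.bilin 1 0 (S₀ z)).bilinearComp (S₀) (((Rinv.comp A).comp Rr).comp (S₀))) := ⟨_, rfl⟩
  rw [← hWdef, ← hVdef]
  set p : E4 := N q with hp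
  have hNp : N p = q := by rw [hp, hNN]
  have hSp : S p = Rr (S₀ q) := by rw [hdec, hNp]
  have hradp : 0 < Kerr.radius 0 (S p) := by rw [hSp, bk_restMap_radius hRiso hR0]; exact hq
  have hU : IsOpen {z : E4 | 0 < Kerr.radius 0 (S z)} :=
    isOpen_lt continuous_const ((Kerr.continuous_radius 0).comp S.continuous)
  have hVW : ∀ z ∈ {z : E4 | 0 < Kerr.radius 0 (S z)}, V z = (W (N z)).bilinearComp N N := by
    intro z hz
    have hz' : 0 < Kerr.radius 0 ((S₀.comp N) z) := by
      have h := hz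
      rw [Set.mem_setOf_eq, hdec, bk_restMap_radius hRiso hR0] at h
      exact h
    rw [hVdef, hWdef]
    dsimp only
    rw [bk_restMap_lieVar hRiso hR0 1 h1 (S₀.comp N) A S d (fun v ↦ by rw [hdec]; rfl) hz']
    exact bk_lieVar_comp_lab (Kerr.bilin 1 0) S₀ N ((Rinv.comp A).comp Rr) (S₀.comp N) (Rinv d) z
      (fun v ↦ rfl)
  have hev : V =ᶠ[𝓝 p] fun z ↦ (W (N z)).bilinearComp N N := by
    filter_upwards [hU.mem_nhds hradp] with z hz
    exact hVW z hz
  have hfd : fderiv ℝ V p = fderiv ℝ (fun z ↦ (W (N z)).bilinearComp N N) p := hev.fderiv_eq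
  have hWd : DifferentiableAt ℝ W (N p) := by
    rw [hNp, hWdef]
    obtain ⟨hU₀, hWc⟩ := coerMomQ_contDiffOn_var 1 0 S₀ ((Rinv.comp A).comp Rr) (Rinv d)
    exact (hWc.contDiffAt (hU₀.mem_nhds hq)).differentiableAt (by simp)
  have hpull : ∀ X U' W' : E4, fderiv ℝ (fun z ↦ (W (N z)).bilinearComp N N) p X U' W' =
      fderiv ℝ W (N p) (N X) (N U') (N W') := fun X U' W' ↦ bk_fderiv_pullback_apply N hWd X U' W'
  simp only [hfd, hpull, hNp, hNN]
  rw [Finset.sum_sub_distrib, bk_labIso_trace hNiso hNN hNe0 (fderiv ℝ W q e),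
    bk_labIso_trace₃ hNiso hNN hNe0 (fderiv ℝ W q) e, ← Finset.sum_sub_distrib]

set_option maxHeartbeats 6400000 in
/-- **Transport of the spin rows.** With the data of `bk_transport_var` and `A` an infinitesimal
rotation `ω`: the rows of the spin first-variation field `spinVar_{(1,A,0)}` (frame `S`) at
`(Nq, Ne)` equal the rows of the scalar Lense–Thirring field with frame `S₀` and SOME spin vector
`σ'` (the adjugate transport of `e₃ × ω`, `bk_restMap_LT`), and `σ' = 0` forces `ω₁ = ω₂ = 0`
(`bk_sigma_eq_zero_of_restMap_LT`). [folklore] -/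
theorem bk_transport_spin (A : E4 →L[ℝ] E4) (ω₁ ω₂ ω₃ : ℝ)
    (hRform : ∀ u : E4, A u = ![0, ω₂ * u 3 - ω₃ * u 2, ω₃ * u 1 - ω₁ * u 3, ω₁ * u 2 - ω₂ * u 1])
    {S S₀ N Rr Rinv : E4 →L[ℝ] E4}
    (hNiso : ∀ u w : E4, Minkowski.bilin (N u) (N w) = Minkowski.bilin u w) (hNN : ∀ w : E4, N (N w) = w)
    (hNe0 : N (E4.basisVector 0) = E4.basisVector 0 ∨ N (E4.basisVector 0) = -E4.basisVector 0)
    (hRiso : ∀ u w : E4, Minkowski.bilin (Rr u) (Rr w) = Minkowski.bilin u w)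
    (hR0 : Rr (E4.basisVector 0) = E4.basisVector 0) (h1 : ∀ w : E4, Rr (Rinv w) = w)
    (hdec : ∀ v : E4, S v = Rr (S₀ (N v))) :
    ∃ σ₁' σ₂' σ₃' : ℝ, (σ₁' = 0 → σ₂' = 0 → σ₃' = 0 → ω₁ = 0 ∧ ω₂ = 0) ∧
      ∀ {q : E4}, 0 < Kerr.radius 0 (S₀ q) → ∀ e : E4,
        ∑ i : Fin 3, (fderiv ℝ (fun z : E4 ↦ ((fderiv ℝ (Kerr.spinMetric 1) (S z) ((A) (S z) + 0)).bilinearComp (S) (S) + (Kerr.spinMetric 1 (S z)).bilinearComp ((A).comp (S)) (S) + (Kerr.spinMetric 1 (S z)).bilinearComp (S) ((A).comp (S)))) (N q) (N e) (E4.basisVector i.succ) (E4.basisVector i.succ)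
            - fderiv ℝ (fun z : E4 ↦ ((fderiv ℝ (Kerr.spinMetric 1) (S z) ((A) (S z) + 0)).bilinearComp (S) (S) + (Kerr.spinMetric 1 (S z)).bilinearComp ((A).comp (S)) (S) + (Kerr.spinMetric 1 (S z)).bilinearComp (S) ((A).comp (S)))) (N q) (E4.basisVector i.succ) (E4.basisVector i.succ) (N e))
          = ∑ i : Fin 3, (fderiv ℝ (fun z : E4 ↦ 2 / E4.spatialNorm (S₀ z) ^ 3 * (ell (S₀ z) (S₀ (E4.basisVector i.succ)) * sdot (S₀ z) (WithLp.toLp 2 ![(0 : ℝ), σ₂' * (S₀ (E4.basisVector i.succ)) 3 - σ₃' * (S₀ (E4.basisVector i.succ)) 2, σ₃' * (S₀ (E4.basisVector i.succ)) 1 - σ₁' * (S₀ (E4.basisVector i.succ)) 3, σ₁' * (S₀ (E4.basisVector i.succ)) 2 - σ₂' * (S₀ (E4.basisVector i.succ)) 1]) + sdot (S₀ z) (WithLp.toLp 2 ![(0 : ℝ), σ₂' * (S₀ (E4.basisVector i.succ)) 3 - σ₃' * (S₀ (E4.basisVector i.succ)) 2, σ₃' * (S₀ (E4.basisVector i.succ))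 1 - σ₁' * (S₀ (E4.basisVector i.succ)) 3, σ₁' * (S₀ (E4.basisVector i.succ)) 2 - σ₂' * (S₀ (E4.basisVector i.succ)) 1]) * ell (S₀ z) (S₀ (E4.basisVector i.succ)))) q e
            - fderiv ℝ (fun z : E4 ↦ 2 / E4.spatialNorm (S₀ z) ^ 3 * (ell (S₀ z) (S₀ (E4.basisVector i.succ)) * sdot (S₀ z) (WithLp.toLp 2 ![(0 : ℝ), σ₂' * (S₀ e) 3 - σ₃' * (S₀ e) 2, σ₃' * (S₀ e) 1 - σ₁' * (S₀ e) 3, σ₁' * (S₀ e) 2 - σ₂' * (S₀ e) 1]) + sdot (S₀ z) (WithLp.toLp 2 ![(0 : ℝ), σ₂' * (S₀ (E4.basisVector i.succ)) 3 - σ₃' * (S₀ (E4.basisVector i.succ)) 2, σ₃' * (S₀ (E4.basisVector i.succ)) 1 - σ₁' * (S₀ (E4.basisVector i.succ)) 3, σ₁' * (S₀ (E4.basisVector i.succ)) 2 - σ₂' * (S₀ (E4.basisVector i.succ)) 1]) * ell (S₀ z) (S₀ e))) q (E4.basisVector i.succ)) := by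
  refine ⟨((Rr (E4.basisVector 2) 2 * Rr (E4.basisVector 3) 3 - Rr (E4.basisVector 3) 2 * Rr (E4.basisVector 2) 3) * (-ω₂) + (Rr (E4.basisVector 3) 1 * Rr (E4.basisVector 2) 3 - Rr (E4.basisVector 2) 1 * Rr (E4.basisVector 3) 3) * ω₁ + (Rr (E4.basisVector 2) 1 * Rr (E4.basisVector 3) 2 - Rr (E4.basisVector 3) 1 * Rr (E4.basisVector 2) 2) * 0), ((Rr (E4.basisVector 3) 2 * Rr (E4.basisVector 1) 3 - Rr (E4.basisVector 1) 2 * Rr (E4.basisVector 3) 3) * (-ω₂) + (Rr (E4.basisVector 1) 1 * Rr (E4.basisVector 3) 3 - Rr (E4.basisVector 3) 1 * Rr (E4.basisVector 1) 3) * ω₁ + (Rr (E4.basisVector 3) 1 * Rr (E4.basisVector 1) 2 - Rr (E4.basisVector 1) 1 * Rr (E4.basisVector 3) 2) * 0), ((Rr (E4.basisVector 1) 2 * Rr (E4.basisVector 2) 3 - Rr (E4.basisVector 2) 2 * Rr (E4.basisVector 1) 3) * (-ω₂) + (Rr (E4.basisVector 2) 1 * Rr (E4.basisVector 1) 3 -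 Rr (E4.basisVector 1) 1 * Rr (E4.basisVector 2) 3) * ω₁ + (Rr (E4.basisVector 1) 1 * Rr (E4.basisVector 2) 2 - Rr (E4.basisVector 2) 1 * Rr (E4.basisVector 1) 2) * 0), ?_, ?_⟩
  · -- back-transport of the spin vector
    intro h1' h2' h3'
    have hzero : ∀ P U W : E4, 2 / E4.spatialNorm (Rr P) ^ 3 *
        (ell (Rr P) (Rr U) * sdot (Rr P) (WithLp.toLp 2 ![(0 : ℝ), ω₁ * (Rr W) 3 - 0 * (Rr W) 2, 0 * (Rr W) 1 - (-ω₂) * (Rr W) 3, (-ω₂) * (Rr W) 2 - ω₁ * (Rr W) 1]) +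
          sdot (Rr P) (WithLp.toLp 2 ![(0 : ℝ), ω₁ * (Rr U) 3 - 0 * (Rr U) 2, 0 * (Rr U) 1 - (-ω₂) * (Rr U) 3, (-ω₂) * (Rr U) 2 - ω₁ * (Rr U) 1]) * ell (Rr P) (Rr W)) = 0 := by
      intro P U W
      rw [bk_restMap_LT hRiso hR0 (-ω₂) ω₁ 0 P U W]
      have e1 : ((Rr (E4.basisVector 2) 2 * Rr (E4.basisVector 3) 3 - Rr (E4.basisVector 3) 2 * Rr (E4.basisVector 2) 3) * (-ω₂) + (Rr (E4.basisVector 3) 1 * Rr (E4.basisVector 2) 3 - Rr (E4.basisVector 2) 1 * Rr (E4.basisVector 3) 3) * ω₁ + (Rr (E4.basisVector 2) 1 * Rr (E4.basisVector 3) 2 - Rr (E4.basisVector 3) 1 * Rr (E4.basisVector 2) 2) * 0) = 0 := h1'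
      have e2 : ((Rr (E4.basisVector 3) 2 * Rr (E4.basisVector 1) 3 - Rr (E4.basisVector 1) 2 * Rr (E4.basisVector 3) 3) * (-ω₂) + (Rr (E4.basisVector 1) 1 * Rr (E4.basisVector 3) 3 - Rr (E4.basisVector 3) 1 * Rr (E4.basisVector 1) 3) * ω₁ + (Rr (E4.basisVector 3) 1 * Rr (E4.basisVector 1) 2 - Rr (E4.basisVector 1) 1 * Rr (E4.basisVector 3) 2) * 0) = 0 := h2'
      have e3 : ((Rr (E4.basisVector 1) 2 * Rr (E4.basisVector 2) 3 - Rr (E4.basisVector 2) 2 * Rr (E4.basisVector 1) 3) * (-ω₂) + (Rr (E4.basisVector 2) 1 * Rr (E4.basisVector 1) 3 - Rr (E4.basisVector 1) 1 * Rr (E4.basisVector 2) 3) * ω₁ + (Rr (E4.basisVector 1) 1 * Rr (E4.basisVector 2) 2 - Rr (E4.basisVector 2) 1 * Rr (E4.basisVector 1) 2) * 0) = 0 := h3'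
      rw [e1, e2, e3]
      simp [sdot_eq]
    obtain ⟨ha, hb, -⟩ := bk_sigma_eq_zero_of_restMap_LT (R := Rr) h1 hzero
    exact ⟨hb, by linarith⟩
  · intro q hq e
    -- the two spin fields: frame `S` and frame `S₁ = R ∘ S₀`
    set S₁ : E4 →L[ℝ] E4 := Rr.comp S₀ with hS₁
    obtain ⟨Sp, hSpdef⟩ : ∃ F : E4 → E4 →L[ℝ] E4 →L[ℝ] ℝ, F = fun z ↦ ((fderiv ℝ (Kerr.spinMetric 1) (S z) ((A) (S z) + 0)).bilinearComp (S) (S) + (Kerr.spinMetric 1 (S z)).bilinearComp ((A).comp (S)) (S) + (Kerr.spinMetric 1 (S z)).bilinearComp (S) ((A).comp (S))) := ⟨_, rfl⟩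
    obtain ⟨Sp₁, hSp₁def⟩ : ∃ F : E4 → E4 →L[ℝ] E4 →L[ℝ] ℝ, F = fun z ↦ ((fderiv ℝ (Kerr.spinMetric 1) (S₁ z) (A (S₁ z) + 0)).bilinearComp S₁ S₁ + (Kerr.spinMetric 1 (S₁ z)).bilinearComp (A.comp S₁) S₁ + (Kerr.spinMetric 1 (S₁ z)).bilinearComp S₁ (A.comp S₁)) := ⟨_, rfl⟩
    rw [← hSpdef]
    have hpb : Sp = fun z ↦ (Sp₁ (N z)).bilinearComp N N := by
      rw [hSpdef, hSp₁def]
      funext z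
      exact bk_lieVar_comp_lab (Kerr.spinMetric 1) S₁ N A S 0 z (fun v ↦ by rw [hdec]; rfl)
    have hradq : 0 < Kerr.radius 0 (S₁ q) := by
      show 0 < Kerr.radius 0 (Rr (S₀ q))
      rw [bk_restMap_radius hRiso hR0]; exact hq
    have hSp₁d : ContDiffAt ℝ ∞ Sp₁ q := by rw [hSp₁def]; exact bk_contDiffAt_spinVar 1 S₁ A 0 hradq
    have hdiff : DifferentiableAt ℝ Sp₁ (N (N q)) := by
      rw [hNN]; exact hSp₁d.differentiableAt (by simp)
    have hpull : ∀ X U' W' : E4, fderiv ℝ Sp (N q) X U' W' = fderiv ℝ Sp₁ (N (N q)) (N X) (N U') (N W') := by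
      intro X U' W'
      rw [hpb]
      exact bk_fderiv_pullback_apply N hdiff X U' W'
    simp only [hpull, hNN]
    rw [Finset.sum_sub_distrib, bk_labIso_trace hNiso hNN hNe0 (fderiv ℝ Sp₁ q e),
      bk_labIso_trace₃ hNiso hNN hNe0 (fderiv ℝ Sp₁ q) e, ← Finset.sum_sub_distrib]
    -- conversion of the frame-`S₁` field to the scalar Lense–Thirring field with frame `S₀`
    have hU₁ : IsOpen {z : E4 | 0 < Kerr.radius 0 (S₁ z)} :=
      isOpen_lt continuous_const ((Kerr.continuous_radius 0).comp S₁.continuous)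
    have hval : ∀ z : E4, 0 < Kerr.radius 0 (S₁ z) → ∀ u w : E4, Sp₁ z u w = 2 / E4.spatialNorm (S₀ z) ^ 3 * (ell (S₀ z) (S₀ u) * sdot (S₀ z) (WithLp.toLp 2 ![(0 : ℝ), (((Rr (E4.basisVector 3) 2 * Rr (E4.basisVector 1) 3 - Rr (E4.basisVector 1) 2 * Rr (E4.basisVector 3) 3) * (-ω₂) + (Rr (E4.basisVector 1) 1 * Rr (E4.basisVector 3) 3 - Rr (E4.basisVector 3) 1 * Rr (E4.basisVector 1) 3) * ω₁ + (Rr (E4.basisVector 3) 1 * Rr (E4.basisVector 1) 2 - Rr (E4.basisVector 1) 1 * Rr (E4.basisVector 3) 2) * 0)) * (S₀ w) 3 - (((Rr (E4.basisVector 1) 2 * Rr (E4.basisVector 2) 3 - Rr (E4.basisVector 2) 2 * Rr (E4.basisVector 1) 3) * (-ω₂) + (Rr (E4.basisVector 2) 1 * Rr (E4.basisVector 1) 3 - Rr (E4.basisVector 1) 1 * Rr (E4.basisVector 2) 3) * ω₁ + (Rr (E4.basisVector 1) 1 * Rr (E4.basisVector 2) 2 - Rr (E4.basisVector 2) 1 *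 Rr (E4.basisVector 1) 2) * 0)) * (S₀ w) 2, (((Rr (E4.basisVector 1) 2 * Rr (E4.basisVector 2) 3 - Rr (E4.basisVector 2) 2 * Rr (E4.basisVector 1) 3) * (-ω₂) + (Rr (E4.basisVector 2) 1 * Rr (E4.basisVector 1) 3 - Rr (E4.basisVector 1) 1 * Rr (E4.basisVector 2) 3) * ω₁ + (Rr (E4.basisVector 1) 1 * Rr (E4.basisVector 2) 2 - Rr (E4.basisVector 2) 1 * Rr (E4.basisVector 1) 2) * 0)) * (S₀ w) 1 - (((Rr (E4.basisVector 2) 2 * Rr (E4.basisVector 3) 3 - Rr (E4.basisVector 3) 2 * Rr (E4.basisVector 2) 3) * (-ω₂) + (Rr (E4.basisVector 3) 1 * Rr (E4.basisVector 2) 3 - Rr (E4.basisVector 2) 1 * Rr (E4.basisVector 3) 3) * ω₁ + (Rr (E4.basisVector 2) 1 * Rr (E4.basisVector 3) 2 - Rr (E4.basisVector 3) 1 * Rr (E4.basisVector 2) 2) * 0)) * (S₀ w) 3, (((Rr (E4.basisVector 2) 2 * Rr (E4.basisVector 3) 3 - Rr (E4.basisVector 3) 2 * Rr (E4.basisVector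 2) 3) * (-ω₂) + (Rr (E4.basisVector 3) 1 * Rr (E4.basisVector 2) 3 - Rr (E4.basisVector 2) 1 * Rr (E4.basisVector 3) 3) * ω₁ + (Rr (E4.basisVector 2) 1 * Rr (E4.basisVector 3) 2 - Rr (E4.basisVector 3) 1 * Rr (E4.basisVector 2) 2) * 0)) * (S₀ w) 2 - (((Rr (E4.basisVector 3) 2 * Rr (E4.basisVector 1) 3 - Rr (E4.basisVector 1) 2 * Rr (E4.basisVector 3) 3) * (-ω₂) + (Rr (E4.basisVector 1) 1 * Rr (E4.basisVector 3) 3 - Rr (E4.basisVector 3) 1 * Rr (E4.basisVector 1) 3) * ω₁ + (Rr (E4.basisVector 3) 1 * Rr (E4.basisVector 1) 2 - Rr (E4.basisVector 1) 1 * Rr (E4.basisVector 3) 2) * 0)) * (S₀ w) 1]) + sdot (S₀ z) (WithLp.toLp 2 ![(0 : ℝ), (((Rr (E4.basisVector 3) 2 * Rr (E4.basisVector 1) 3 - Rr (E4.basisVector 1) 2 * Rr (E4.basisVector 3) 3) * (-ω₂) + (Rr (E4.basisVector 1) 1 * Rr (E4.basisVector 3) 3 - Rr (E4.basisVector 3)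 1 * Rr (E4.basisVector 1) 3) * ω₁ + (Rr (E4.basisVector 3) 1 * Rr (E4.basisVector 1) 2 - Rr (E4.basisVector 1) 1 * Rr (E4.basisVector 3) 2) * 0)) * (S₀ u) 3 - (((Rr (E4.basisVector 1) 2 * Rr (E4.basisVector 2) 3 - Rr (E4.basisVector 2) 2 * Rr (E4.basisVector 1) 3) * (-ω₂) + (Rr (E4.basisVector 2) 1 * Rr (E4.basisVector 1) 3 - Rr (E4.basisVector 1) 1 * Rr (E4.basisVector 2) 3) * ω₁ + (Rr (E4.basisVector 1) 1 * Rr (E4.basisVector 2) 2 - Rr (E4.basisVector 2) 1 * Rr (E4.basisVector 1) 2) * 0)) * (S₀ u) 2, (((Rr (E4.basisVector 1) 2 * Rr (E4.basisVector 2) 3 - Rr (E4.basisVector 2) 2 * Rr (E4.basisVector 1) 3) * (-ω₂) + (Rr (E4.basisVector 2) 1 * Rr (E4.basisVector 1) 3 - Rr (E4.basisVector 1) 1 * Rr (E4.basisVector 2) 3) * ω₁ + (Rr (E4.basisVector 1) 1 * Rr (E4.basisVector 2) 2 - Rr (E4.basisVector 2) 1 * Rr (E4.basisVector 1) 2) *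 0)) * (S₀ u) 1 - (((Rr (E4.basisVector 2) 2 * Rr (E4.basisVector 3) 3 - Rr (E4.basisVector 3) 2 * Rr (E4.basisVector 2) 3) * (-ω₂) + (Rr (E4.basisVector 3) 1 * Rr (E4.basisVector 2) 3 - Rr (E4.basisVector 2) 1 * Rr (E4.basisVector 3) 3) * ω₁ + (Rr (E4.basisVector 2) 1 * Rr (E4.basisVector 3) 2 - Rr (E4.basisVector 3) 1 * Rr (E4.basisVector 2) 2) * 0)) * (S₀ u) 3, (((Rr (E4.basisVector 2) 2 * Rr (E4.basisVector 3) 3 - Rr (E4.basisVector 3) 2 * Rr (E4.basisVector 2) 3) * (-ω₂) + (Rr (E4.basisVector 3) 1 * Rr (E4.basisVector 2) 3 - Rr (E4.basisVector 2) 1 * Rr (E4.basisVector 3) 3) * ω₁ + (Rr (E4.basisVector 2) 1 * Rr (E4.basisVector 3) 2 - Rr (E4.basisVector 3) 1 * Rr (E4.basisVector 2) 2) * 0)) * (S₀ u) 2 - (((Rr (E4.basisVector 3) 2 * Rr (E4.basisVector 1) 3 - Rr (E4.basisVector 1) 2 * Rr (E4.basisVector 3) 3) * (-ω₂) + (Rr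 (E4.basisVector 1) 1 * Rr (E4.basisVector 3) 3 - Rr (E4.basisVector 3) 1 * Rr (E4.basisVector 1) 3) * ω₁ + (Rr (E4.basisVector 3) 1 * Rr (E4.basisVector 1) 2 - Rr (E4.basisVector 1) 1 * Rr (E4.basisVector 3) 2) * 0)) * (S₀ u) 1]) * ell (S₀ z) (S₀ w)) := by
      intro z hz u w
      rw [hSp₁def]
      dsimp only
      rw [spinVar_apply_eq 1 S₁ A ω₁ ω₂ ω₃ hRform hz u w, mul_one]
      exact bk_restMap_LT hRiso hR0 (-ω₂) ω₁ 0 (S₀ z) (S₀ u) (S₀ w)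
    have hDSp₁ : DifferentiableAt ℝ Sp₁ q := hSp₁d.differentiableAt (by simp)
    have heval : ∀ X U' W' : E4, fderiv ℝ Sp₁ q X U' W' = fderiv ℝ (fun z ↦ Sp₁ z U' W') q X := by
      intro X U' W'
      have hd1 : DifferentiableAt ℝ (fun z ↦ Sp₁ z U') q := differentiableAt_clm_apply_const hDSp₁ U'
      rw [fderiv_clm_apply_const hd1 W' X, fderiv_clm_apply_const hDSp₁ U' X]
    have hfun : ∀ U' W' : E4, (fun z ↦ Sp₁ z U' W') =ᶠ[𝓝 q] fun z ↦ 2 / E4.spatialNorm (S₀ z) ^ 3 * (ell (S₀ z) (S₀ U') * sdot (S₀ z) (WithLp.toLp 2 ![(0 : ℝ), (((Rr (E4.basisVector 3) 2 * Rr (E4.basisVector 1) 3 - Rr (E4.basisVector 1) 2 * Rr (E4.basisVector 3) 3) * (-ω₂) + (Rr (E4.basisVector 1) 1 * Rr (E4.basisVector 3) 3 - Rr (E4.basisVector 3) 1 * Rr (E4.basisVector 1) 3) * ω₁ + (Rr (E4.basisVector 3) 1 * Rr (E4.basisVector 1) 2 - Rr (E4.basisVector 1) 1 * Rr (E4.basisVector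 3) 2) * 0)) * (S₀ W') 3 - (((Rr (E4.basisVector 1) 2 * Rr (E4.basisVector 2) 3 - Rr (E4.basisVector 2) 2 * Rr (E4.basisVector 1) 3) * (-ω₂) + (Rr (E4.basisVector 2) 1 * Rr (E4.basisVector 1) 3 - Rr (E4.basisVector 1) 1 * Rr (E4.basisVector 2) 3) * ω₁ + (Rr (E4.basisVector 1) 1 * Rr (E4.basisVector 2) 2 - Rr (E4.basisVector 2) 1 * Rr (E4.basisVector 1) 2) * 0)) * (S₀ W') 2, (((Rr (E4.basisVector 1) 2 * Rr (E4.basisVector 2) 3 - Rr (E4.basisVector 2) 2 * Rr (E4.basisVector 1) 3) * (-ω₂) + (Rr (E4.basisVector 2) 1 * Rr (E4.basisVector 1) 3 - Rr (E4.basisVector 1) 1 * Rr (E4.basisVector 2) 3) * ω₁ + (Rr (E4.basisVector 1) 1 * Rr (E4.basisVector 2) 2 - Rr (E4.basisVector 2) 1 * Rr (E4.basisVector 1) 2) * 0)) * (S₀ W') 1 - (((Rr (E4.basisVector 2) 2 * Rr (E4.basisVector 3) 3 - Rr (E4.basisVector 3) 2 * Rr (E4.basisVector 2) 3) * (-ω₂)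 + (Rr (E4.basisVector 3) 1 * Rr (E4.basisVector 2) 3 - Rr (E4.basisVector 2) 1 * Rr (E4.basisVector 3) 3) * ω₁ + (Rr (E4.basisVector 2) 1 * Rr (E4.basisVector 3) 2 - Rr (E4.basisVector 3) 1 * Rr (E4.basisVector 2) 2) * 0)) * (S₀ W') 3, (((Rr (E4.basisVector 2) 2 * Rr (E4.basisVector 3) 3 - Rr (E4.basisVector 3) 2 * Rr (E4.basisVector 2) 3) * (-ω₂) + (Rr (E4.basisVector 3) 1 * Rr (E4.basisVector 2) 3 - Rr (E4.basisVector 2) 1 * Rr (E4.basisVector 3) 3) * ω₁ + (Rr (E4.basisVector 2) 1 * Rr (E4.basisVector 3) 2 - Rr (E4.basisVector 3) 1 * Rr (E4.basisVector 2) 2) * 0)) * (S₀ W') 2 - (((Rr (E4.basisVector 3) 2 * Rr (E4.basisVector 1) 3 - Rr (E4.basisVector 1) 2 * Rr (E4.basisVector 3) 3) * (-ω₂) + (Rr (E4.basisVector 1) 1 * Rr (E4.basisVector 3) 3 - Rr (E4.basisVector 3) 1 * Rr (E4.basisVector 1) 3) * ω₁ + (Rr (E4.basisVector 3) 1 * Rr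 (E4.basisVector 1) 2 - Rr (E4.basisVector 1) 1 * Rr (E4.basisVector 3) 2) * 0)) * (S₀ W') 1]) + sdot (S₀ z) (WithLp.toLp 2 ![(0 : ℝ), (((Rr (E4.basisVector 3) 2 * Rr (E4.basisVector 1) 3 - Rr (E4.basisVector 1) 2 * Rr (E4.basisVector 3) 3) * (-ω₂) + (Rr (E4.basisVector 1) 1 * Rr (E4.basisVector 3) 3 - Rr (E4.basisVector 3) 1 * Rr (E4.basisVector 1) 3) * ω₁ + (Rr (E4.basisVector 3) 1 * Rr (E4.basisVector 1) 2 - Rr (E4.basisVector 1) 1 * Rr (E4.basisVector 3) 2) * 0)) * (S₀ U') 3 - (((Rr (E4.basisVector 1) 2 * Rr (E4.basisVector 2) 3 - Rr (E4.basisVector 2) 2 * Rr (E4.basisVector 1) 3) * (-ω₂) + (Rr (E4.basisVector 2) 1 * Rr (E4.basisVector 1) 3 - Rr (E4.basisVector 1) 1 * Rr (E4.basisVector 2) 3) * ω₁ + (Rr (E4.basisVector 1) 1 * Rr (E4.basisVector 2) 2 - Rr (E4.basisVector 2) 1 * Rr (E4.basisVector 1) 2) * 0)) * (S₀ U') 2,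 (((Rr (E4.basisVector 1) 2 * Rr (E4.basisVector 2) 3 - Rr (E4.basisVector 2) 2 * Rr (E4.basisVector 1) 3) * (-ω₂) + (Rr (E4.basisVector 2) 1 * Rr (E4.basisVector 1) 3 - Rr (E4.basisVector 1) 1 * Rr (E4.basisVector 2) 3) * ω₁ + (Rr (E4.basisVector 1) 1 * Rr (E4.basisVector 2) 2 - Rr (E4.basisVector 2) 1 * Rr (E4.basisVector 1) 2) * 0)) * (S₀ U') 1 - (((Rr (E4.basisVector 2) 2 * Rr (E4.basisVector 3) 3 - Rr (E4.basisVector 3) 2 * Rr (E4.basisVector 2) 3) * (-ω₂) + (Rr (E4.basisVector 3) 1 * Rr (E4.basisVector 2) 3 - Rr (E4.basisVector 2) 1 * Rr (E4.basisVector 3) 3) * ω₁ + (Rr (E4.basisVector 2) 1 * Rr (E4.basisVector 3) 2 - Rr (E4.basisVector 3) 1 * Rr (E4.basisVector 2) 2) * 0)) * (S₀ U') 3, (((Rr (E4.basisVector 2) 2 * Rr (E4.basisVector 3) 3 - Rr (E4.basisVector 3) 2 * Rr (E4.basisVector 2) 3) * (-ω₂) + (Rr (E4.basisVector 3) 1 *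 Rr (E4.basisVector 2) 3 - Rr (E4.basisVector 2) 1 * Rr (E4.basisVector 3) 3) * ω₁ + (Rr (E4.basisVector 2) 1 * Rr (E4.basisVector 3) 2 - Rr (E4.basisVector 3) 1 * Rr (E4.basisVector 2) 2) * 0)) * (S₀ U') 2 - (((Rr (E4.basisVector 3) 2 * Rr (E4.basisVector 1) 3 - Rr (E4.basisVector 1) 2 * Rr (E4.basisVector 3) 3) * (-ω₂) + (Rr (E4.basisVector 1) 1 * Rr (E4.basisVector 3) 3 - Rr (E4.basisVector 3) 1 * Rr (E4.basisVector 1) 3) * ω₁ + (Rr (E4.basisVector 3) 1 * Rr (E4.basisVector 1) 2 - Rr (E4.basisVector 1) 1 * Rr (E4.basisVector 3) 2) * 0)) * (S₀ U') 1]) * ell (S₀ z) (S₀ W')) := by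
      intro U' W'
      filter_upwards [hU₁.mem_nhds hradq] with z hz
      exact hval z hz U' W'
    refine Finset.sum_congr rfl fun i _ ↦ ?_
    rw [heval, heval, (hfun _ _).fderiv_eq, (hfun _ _).fderiv_eq]

/-- **Registered carrier** `bk_transport_carrier` of the crux item (one-line form of
`bk_radius_pos_slice`, for the `--supports` protocol). [folklore] -/
theorem bk_transport_carrier : open Literature.Geometry.Lorentzian in ∀ (L : lorentzGroup) {x : E4}, x 0 = 0 → x ≠ 0 → 0 < Kerr.radius 0 (((L : E4 ≃L[ℝ] E4).symm : E4 →L[ℝ] E4) x) :=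
  fun L _ hx0 hx ↦ bk_radius_pos_slice L hx0 hx

end Summit.FinalStateConjecture.FinalStateConjecture.Theorems.SublinearIsFree.Slaving

end
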